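import Summits.ValiantsHypothesis.ValiantsHypothesis.Theses.DivisionGap
import Literature.Computability.AlgebraicComplexity.PermanentIrreducible
import Literature.Computability.AlgebraicComplexity.RankOneDeterminantalExpressionsProofs

/-!
# `DivisionGap.PerCofactorDegreeReduction` (stmt-ValiantsHypothesis-15046), line `Sketch`:
# the first signed cofactor of `per₃` has degree `5 = n + 2` — the window of
# `stub_automaticPositivity` is sharp at `n = 3` as well, by the GENERAL mechanism

Companion of `Negative/AutomaticPositivityTight.lean` (`n = 2`).  The general recipe behind
`d*(n) = n + 2` (first degree of a signed cofactor `q` with `per_n · q ≥ 0`): take the exponent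
`m = x₀₀ ⋯ x_{n-3,n-3} · (2 × 2 block)`; for every permutation `σ` there is a second permutation
`τ(σ) ≤ σ + m`, and with `M_σ := x^{m+σ-τ(σ)}` one has the POSITIVE identity

  `per_n · (Σ_σ M_σ − x^m) = Σ_σ M_σ · (per_n − x^{τ(σ)})`,

whose right-hand side has nonnegative coefficients.  Here this is kernel-checked at `n = 3`
(`m = x₀₀ · x₁₁x₁₂x₂₁x₂₂`; `τ(σ) = id` for `σ ≠ id`, `τ(id) = (1 2)`):

* `q3 = x₁₂x₂₁·(per₃ − x₀₀x₁₁x₂₂) + x₀₀x₁₁²x₂₂² − x₀₀x₁₁x₁₂x₂₁x₂₂`, degree `5`,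
* `perPoly_three_mul_q3` — `per₃ · q3 = x₀₀x₁₁²x₂₂² · R_a + x₁₂x₂₁ · R_id²` with `R_a`, `R_id` the
  five-term complements of the permutation monomials `x₀₀x₂₁x₁₂`, `x₀₀x₁₁x₂₂` in `per₃` — the real
  image of a polynomial over `ℝ≥0`, hence coefficientwise `≥ 0` (`coeff_perPoly_three_mul_q3_nonneg`),
* `coeff_q3_neg` — the coefficient of `x₀₀x₁₁x₁₂x₂₁x₂₂` in `q3` is `−1`,
* `exists_signed_cofactor_three` — packaged: a signed cofactor of degree `≤ 3 + 2` at `n = 3`.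

Reading for K2 (`stub_cheapPositivization`): the positivizer of `q3` exhibited by the identity is
`per₃` itself; the identity is the shape every positivization `p · q ≥ 0` must take monomial by monomial.

All statements are inline (no new named facts); names live in the sub-namespace `Three`.
-/

noncomputable section

namespace Summit.ValiantsHypothesis.Theorems.PerCofactorDegreeReductionNegative.Three

open MvPolynomial Literature.Computability.AlgebraicComplexity
open scoped NNReal

section Defs

variable (R : Type*) [CommSemiring R]

/-- Shorthand for the variable `x_{ij}`, `i j : Fin 3`. -/
abbrev x (i j : Fin 3) : MvPolynomial (Fin 3 × Fin 3) R := X (i, j)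

/-- The six permutation monomials of `per₃` (cells `(row, col)`): `id`. [folklore] -/
def pid : MvPolynomial (Fin 3 × Fin 3) R := x R 0 0 * x R 1 1 * x R 2 2
/-- Permutation monomial `a = (0,0)(2,1)(1,2)`. [folklore] -/
def pa : MvPolynomial (Fin 3 × Fin 3) R := x R 0 0 * x R 2 1 * x R 1 2
/-- Permutation monomial `b = (1,0)(0,1)(2,2)`. [folklore] -/
def pb : MvPolynomial (Fin 3 × Fin 3) R := x R 1 0 * x R 0 1 * x R 2 2
/-- Permutation monomial `c = (1,0)(2,1)(0,2)`. [folklore] -/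
def pc : MvPolynomial (Fin 3 × Fin 3) R := x R 1 0 * x R 2 1 * x R 0 2
/-- Permutation monomial `d = (2,0)(0,1)(1,2)`. [folklore] -/
def pd : MvPolynomial (Fin 3 × Fin 3) R := x R 2 0 * x R 0 1 * x R 1 2
/-- Permutation monomial `e = (2,0)(1,1)(0,2)`. [folklore] -/
def pe : MvPolynomial (Fin 3 × Fin 3) R := x R 2 0 * x R 1 1 * x R 0 2

/-- `per₃` is the sum of its six permutation monomials (tree: `permanent_fin_three`). [folklore] -/
theorem perPoly_three_eq : perPoly (Fin 3) R = pid R + pa R + pb R + pc R + pd R + pe R := by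
  rw [perPoly, permanent_fin_three, pid, pa, pb, pc, pd, pe]
  simp only [Matrix.mvPolynomialX_apply]
  ring

/-- `R_id = per₃ − x^{id}` written positively. [folklore] -/
def Rid : MvPolynomial (Fin 3 × Fin 3) R := pa R + pb R + pc R + pd R + pe R

/-- `R_a = per₃ − x^{a}` written positively. [folklore] -/
def Ra : MvPolynomial (Fin 3 × Fin 3) R := pid R + pb R + pc R + pd R + pe R

/-- The positive part `Σ_σ M_σ = x₁₂x₂₁ · R_id + x₀₀x₁₁²x₂₂²` of the signed cofactor. [folklore] -/
def Mpos : MvPolynomial (Fin 3 × Fin 3) R :=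
  x R 1 2 * x R 2 1 * Rid R + x R 0 0 * x R 1 1 * x R 1 1 * x R 2 2 * x R 2 2

/-- The negative monomial `x^m = x₀₀x₁₁x₁₂x₂₁x₂₂`. [folklore] -/
def xm : MvPolynomial (Fin 3 × Fin 3) R := x R 0 0 * x R 1 1 * x R 1 2 * x R 2 1 * x R 2 2

/-- The manifestly nonnegative product `G = x₀₀x₁₁²x₂₂² · R_a + x₁₂x₂₁ · R_id²`. [folklore] -/
def G : MvPolynomial (Fin 3 × Fin 3) R :=
  x R 0 0 * x R 1 1 * x R 1 1 * x R 2 2 * x R 2 2 * Ra R + x R 1 2 * x R 2 1 * Rid R * Rid R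

/-- **The positive identity** `per₃ · Σ_σ M_σ = G + per₃ · x^m` (subtraction-free form of
`per₃ · (Σ_σ M_σ − x^m) = Σ_σ M_σ (per₃ − x^{τ(σ)})`). [folklore] -/
theorem perPoly_three_mul_Mpos : perPoly (Fin 3) R * Mpos R = G R + perPoly (Fin 3) R * xm R := by
  rw [perPoly_three_eq]
  unfold Mpos G xm Rid Ra pid pa pb pc pd pe
  ring

end Defs

/-- The signed cofactor `q3 = Σ_σ M_σ − x^m` over `ℝ` (degree `5 = n + 2`). [folklore] -/
def q3 : MvPolynomial (Fin 3 × Fin 3) ℝ := Mpos ℝ - xm ℝ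

/-- `per₃ · q3 = G` over `ℝ`. [folklore] -/
theorem perPoly_three_mul_q3 : perPoly (Fin 3) ℝ * q3 = G ℝ := by
  rw [q3, mul_sub, perPoly_three_mul_Mpos]
  ring

/-- `G` over `ℝ` is the image of `G` over `ℝ≥0`. [folklore] -/
theorem map_G : MvPolynomial.map NNReal.toRealHom (G ℝ≥0) = G ℝ := by
  simp [G, Ra, Rid, pid, pa, pb, pc, pd, pe, map_X]

/-- `per₃ · q3 ≥ 0` coefficientwise. [folklore] -/
theorem coeff_perPoly_three_mul_q3_nonneg (w : (Fin 3 × Fin 3) →₀ ℕ) :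
    0 ≤ coeff w (perPoly (Fin 3) ℝ * q3) := by
  rw [perPoly_three_mul_q3, ← map_G, coeff_map]
  exact NNReal.coe_nonneg _

/-- `q3` is a quintic form, so `deg q3 ≤ 5`. [folklore] -/
theorem totalDegree_q3_le : q3.totalDegree ≤ 3 + 2 := by
  have hX : ∀ i j : Fin 3, (x ℝ i j).IsHomogeneous 1 := fun i j => isHomogeneous_X ℝ _
  have h3 : ∀ p ∈ [pa ℝ, pb ℝ, pc ℝ, pd ℝ, pe ℝ], p.IsHomogeneous 3 := by
    intro p hp
    simp only [List.mem_cons, List.not_mem_nil, or_false] at hp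
    rcases hp with rfl | rfl | rfl | rfl | rfl <;>
      exact ((hX _ _).mul (hX _ _)).mul (hX _ _)
  have hRid : (Rid ℝ).IsHomogeneous 3 :=
    ((((h3 _ (by simp)).add (h3 _ (by simp))).add (h3 _ (by simp))).add (h3 _ (by simp))).add
      (h3 _ (by simp))
  have hM : (Mpos ℝ).IsHomogeneous 5 :=
    (((hX _ _).mul (hX _ _)).mul hRid).add (((((hX _ _).mul (hX _ _)).mul (hX _ _)).mul (hX _ _)).mul
      (hX _ _))
  have hm : (xm ℝ).IsHomogeneous 5 := ((((hX _ _).mul (hX _ _)).mul (hX _ _)).mul (hX _ _)).mul (hX _ _)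
  exact (hM.sub hm).totalDegree_le

/-- The exponent of `x^m = x₀₀x₁₁x₁₂x₂₁x₂₂` (in the product order of `xm`). [folklore] -/
def em : (Fin 3 × Fin 3) →₀ ℕ :=
  Finsupp.single ((0 : Fin 3), (0 : Fin 3)) 1 + Finsupp.single ((1 : Fin 3), (1 : Fin 3)) 1 +
    Finsupp.single ((1 : Fin 3), (2 : Fin 3)) 1 + Finsupp.single ((2 : Fin 3), (1 : Fin 3)) 1 +
    Finsupp.single ((2 : Fin 3), (2 : Fin 3)) 1

/-- `x^m` as a monomial. [folklore] -/
theorem xm_eq : xm ℝ = monomial em 1 := by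
  unfold xm x em
  simp only [X, monomial_mul, mul_one]

/-- The coefficient of `x^m` in the positive part vanishes (each of its six monomials differs from
`x^m`: it carries `x₁₂²`, `x₀₁`, `x₀₂`, `x₂₀`, `x₂₀`, `x₁₁²` respectively). [folklore] -/
theorem coeff_em_Mpos : coeff em (Mpos ℝ) = 0 := by
  unfold Mpos Rid pa pb pc pd pe x
  simp only [X, monomial_mul, mul_add, coeff_add, coeff_monomial, mul_one]
  have key : ∀ s : (Fin 3 × Fin 3) →₀ ℕ, (⇑s ≠ ⇑em) → (if s = em then (1 : ℝ) else 0) = 0 :=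
    fun s hs => if_neg fun h => hs (by rw [h])
  rw [key, key, key, key, key, key]
  · norm_num
  all_goals
    simp only [em, Finsupp.coe_add, Finsupp.single_eq_pi_single]
    decide

/-- **The coefficient of `x^m` in `q3` is `−1`.** [folklore] -/
theorem coeff_q3_neg : coeff em q3 = -1 := by
  rw [q3, coeff_sub, coeff_em_Mpos, xm_eq, coeff_monomial, if_pos rfl]
  norm_num

/-- **A signed cofactor of degree `n + 2` at `n = 3`**: `deg q3 ≤ 5`, `per₃ · q3 ≥ 0`,
`coeff_{x^m} q3 = −1`.  With `Negative/AutomaticPositivityTight.lean` (`n = 2`): the window `n + 1`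
of `stub_automaticPositivity` is attained-plus-one at `n = 2` and `n = 3` by the same mechanism.
[folklore] -/
theorem exists_signed_cofactor_three :
    ∃ q : MvPolynomial (Fin 3 × Fin 3) ℝ, q.totalDegree ≤ 3 + 2 ∧
      (∀ w, 0 ≤ coeff w (perPoly (Fin 3) ℝ * q)) ∧ ∃ w, coeff w q < 0 :=
  ⟨q3, totalDegree_q3_le, coeff_perPoly_three_mul_q3_nonneg, em, by rw [coeff_q3_neg]; norm_num⟩

/-- The same, as a refutation of the widened window at `n = 3` specifically. [folklore] -/
theorem not_automaticPositivity_add_two_at_three :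
    ¬ ∀ (q : MvPolynomial (Fin 3 × Fin 3) ℝ), q.totalDegree ≤ 3 + 2 →
        (∀ w, 0 ≤ coeff w (perPoly (Fin 3) ℝ * q)) → ∀ w, 0 ≤ coeff w q := by
  intro H
  have h := H q3 totalDegree_q3_le coeff_perPoly_three_mul_q3_nonneg em
  rw [coeff_q3_neg] at h
  norm_num at h

end Summit.ValiantsHypothesis.Theorems.PerCofactorDegreeReductionNegative.Three

end
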